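import Summits.QuantumFields.YangMills.Theorems.FlatTubeReductionTubeMaximiserWitness
import Summits.QuantumFields.YangMills.Theorems.FlatTubeReductionOffTubeSuppressionPrelim
import Literature.Analysis.OperatorTheory.CompactPositiveTopLevel
import Summits.QuantumFields.YangMills.Theses.FlatTubeReduction
import HarnessLib

/-!
# The tube maximiser: the Rayleigh quotient of the zero-flux transfer form over tube-supported physical states `⊥ Ω` is attained
# (support item `TubeMaximiser` of route `FlatTubeReduction`, stmt-QuantumFields-24923, PROVED; rung R2b1 = RECORD-label femto gap)

Seat `ym-line-sfw-p1` g9 (prover; planner-of-record ym-idea-1).  For every `L ≥ 1`, `θ > 0`, `β > 0` and every physical `Ω`, the supremum of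
`⟨φ, K_β φ⟩/‖φ‖²` over `V = {physical φ ⊥ Ω vanishing where β^{−θ} < S}` is attained by a non-null `ψ ∈ V`
(★★ `tubeMaximiser_core`, VERBATIM the body of `Summit.QuantumFields.YangMills.Theses.FlatTubeReduction.TubeMaximiser`; ★★★
`FlatTubeReduction.tubeMaximiser_proof` concludes the route decl BY NAME).

Proof (Reed–Simon IV, Thm XIII.1 pattern, over the tree's `L²` dictionary `FemtoTransferGapPhysL2`): let `K ⊆ L²(configMeasure)` be the closure
of the classes of `V` (inside the physical closed subspace, orthogonal to `Ω` and to every physical class supported off the tube) and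
`T = P_K A|_K` the compression of the compact self-adjoint kernel operator `A` of `K_β` (`PhysL2.exists_transferOpL2`); `T` is compact,
self-adjoint and `≥ 0` (`PhysL2.inner_apply_nonneg`), and `K ≠ {0}` (`TubeMax.exists_tube_witness`).  The top of a compact positive operator is an
attained eigenvalue (Lit `CompactPositiveTopLevel.exists_top_eigenvector_of_dense`): `T x = λ x`, `‖x‖ = 1`, `⟪y,Ty⟫ ≤ λ‖y‖²` on `K`.
If `λ ≤ 0` every admissible Rayleigh quotient vanishes and the witness is a maximiser.  If `λ > 0`, `x` has the ADMISSIBLE representative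
`ψ = λ⁻¹(1_T·K_βx − c·1_TΩ)`: `K_βx` is a physical function with class `Ax` (`PhysL2.isPhys_transferApply_coe`), its tube cut-off re-orthogonalised
against `Ω` is admissible (indicator cut-offs are physical, `OffTube.isPhys_indicator_tube`), and it IS `P_K(Ax)` because the difference
`1_{Tᶜ}K_βx + c·1_TΩ` is orthogonal to `K`; so `‖ψ‖² = 1`, `⟨ψ,K_βψ⟩ = λ`, and maximality is `⟪y,Ty⟫ ≤ λ‖y‖²`.

HONEST FRAMING: routine fixed-lattice functional analysis (the planner's difficulty rating: support); it says nothing about the Born–Oppenheimer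
cruxes K1a/K1b, infinite volume, the continuum, or the Clay Yang–Mills mass gap.  No definitions, no named facts, no `sorry`.
-/

set_option autoImplicit false

noncomputable section

open MeasureTheory Filter Topology Real
open Literature.MathematicalPhysics.QuantumFieldTheory
open Literature.MathematicalPhysics.QuantumLattice
open Literature.Analysis.OperatorTheory
open scoped InnerProductSpace

namespace Summit.QuantumFields.YangMills.Theorems.FemtoTransferGap

namespace TubeMax

open Summit.QuantumFields.YangMills.Theorems.FemtoTransferGap.PhysL2
open Summit.QuantumFields.YangMills.Theorems.FemtoTransferGap.OffTube

variable {L : ℕ} [NeZero L]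

/-! ## §1 The abstract input: top eigenvector of a compact positive self-adjoint operator (real Hilbert space) -/

/-- Real-Hilbert-space form of Lit `exists_top_eigenvector_of_dense` (dense subspace `= ⊤`): a compact self-adjoint operator which is
positive as a form has a unit eigenvector `x`, `T x = λ x`, whose eigenvalue dominates the form: `⟪y, T y⟫ ≤ λ ‖y‖²`.
[cite: ReedSimonIV1978, Thm. XIII.1] -/
theorem exists_top_eigen_real {G : Type*} [NormedAddCommGroup G] [InnerProductSpace ℝ G] [CompleteSpace G] [Nontrivial G]
    (T : G →L[ℝ] G) (hT : IsSelfAdjoint T) (hc : IsCompactOperator T) (hpos : ∀ x : G, 0 ≤ ⟪x, T x⟫_ℝ) :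
    ∃ (x : G) (lam : ℝ), ‖x‖ = 1 ∧ T x = lam • x ∧ ∀ y : G, ⟪y, T y⟫_ℝ ≤ lam * ‖y‖ ^ 2 := by
  have hpos' : ∀ x : G, 0 ≤ RCLike.re ⟪x, T x⟫_ℝ := fun x => by simpa using hpos x
  have hD : Dense ((⊤ : Submodule ℝ G) : Set G) := by simp
  obtain ⟨x, hx, hTx, hdom⟩ := exists_top_eigenvector_of_dense T hT hc hpos' ⊤ hD
  exact ⟨x, _, hx, hTx, fun y => by simpa using hdom y⟩

/-! ## §2 The tube maximiser -/

set_option maxHeartbeats 400000 in -- one long `L²` assembly (twice the default): the heartbeats go into coercion unification, not search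
/-- ★★ **The tube maximiser** — VERBATIM the body of `Summit.QuantumFields.YangMills.Theses.FlatTubeReduction.TubeMaximiser`
(item stmt-QuantumFields-24923): for every `L`, `θ > 0`, `β > 0` and physical `Ω` there is a physical `ψ ⊥ Ω`, vanishing where `β^{−θ} < S`,
with `0 < ‖ψ‖²`, whose Rayleigh quotient dominates that of every such `φ` (cross-multiplied form). [cite: ReedSimonIV1978, Thm. XIII.1] -/
theorem tubeMaximiser_core (L : ℕ) [NeZero L] (θ β : ℝ) (_hθ : 0 < θ) (hβ : 0 < β)
    (Ω : GaugeConfig 3 L SU2 → ℝ) (hΩ : IsPhys Ω) :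
    ∃ ψ : GaugeConfig 3 L SU2 → ℝ, IsPhys ψ ∧ l2 ψ Ω = 0 ∧
      (∀ U, β ^ (-θ) < wilsonAction su2Rep U → ψ U = 0) ∧ 0 < l2 ψ ψ ∧
      ∀ φ : GaugeConfig 3 L SU2 → ℝ, IsPhys φ → l2 φ Ω = 0 →
        (∀ U, β ^ (-θ) < wilsonAction su2Rep U → φ U = 0) →
        qform su2Rep β φ φ * l2 ψ ψ ≤ qform su2Rep β ψ ψ * l2 φ φ := by
  set η : ℝ := β ^ (-θ) with hη
  have hη0 : 0 < η := Real.rpow_pos_of_pos hβ _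
  set Tb : Set (GaugeConfig 3 L SU2) := {U | wilsonAction su2Rep U ≤ η} with hTb
  have hnotin : ∀ U, U ∉ Tb ↔ η < wilsonAction su2Rep U := fun U => by
    simp only [hTb, Set.mem_setOf_eq, not_le]
  -- the `L²` kernel operator
  obtain ⟨A, hA, hAsa, hAc⟩ := exists_transferOpL2 (L := L) β
  have hAsym : ∀ u w : Lp ℝ 2 (configMeasure SU2 L), ⟪A u, w⟫_ℝ = ⟪u, A w⟫_ℝ := fun u w =>
    (ContinuousLinearMap.isSelfAdjoint_iff_isSymmetric.1 hAsa) u w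
  -- the admissible classes and their closed span `K`
  set S₀ : Set (Lp ℝ 2 (configMeasure SU2 L)) :=
    {v | ∃ ψ : physSubmodule L, l2 (ψ : GaugeConfig 3 L SU2 → ℝ) Ω = 0 ∧
      (∀ U, η < wilsonAction su2Rep U → (ψ : GaugeConfig 3 L SU2 → ℝ) U = 0) ∧ v = toL2 ψ} with hS₀
  obtain ⟨K, hKdef⟩ : ∃ K : Submodule ℝ (Lp ℝ 2 (configMeasure SU2 L)), K = (Submodule.span ℝ S₀).topologicalClosure := ⟨_, rfl⟩
  haveI : CompleteSpace K := by rw [hKdef]; infer_instance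
  have hS₀K : ∀ {ψ : physSubmodule L}, l2 (ψ : GaugeConfig 3 L SU2 → ℝ) Ω = 0 →
      (∀ U, η < wilsonAction su2Rep U → (ψ : GaugeConfig 3 L SU2 → ℝ) U = 0) → toL2 ψ ∈ K := by
    intro ψ h1 h2
    rw [hKdef]
    exact Submodule.le_topologicalClosure _ (Submodule.subset_span ⟨ψ, h1, h2, rfl⟩)
  -- (K1) `K` lies in the physical closed subspace
  have hKphys : K ≤ physL2 L := by
    rw [hKdef]
    refine Submodule.topologicalClosure_minimal _ (Submodule.span_le.2 ?_) isClosed_physL2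
    rintro v ⟨ψ, -, -, rfl⟩
    exact toL2_mem_physL2 ψ
  -- (K2)/(K3) `K` is orthogonal to the class of any physical function `u` with `l2 u ψ = 0` for all admissible `ψ`
  have hKorth : ∀ (u : physSubmodule L),
      (∀ ψ : physSubmodule L, l2 (ψ : GaugeConfig 3 L SU2 → ℝ) Ω = 0 →
        (∀ U, η < wilsonAction su2Rep U → (ψ : GaugeConfig 3 L SU2 → ℝ) U = 0) →
        l2 (u : GaugeConfig 3 L SU2 → ℝ) ψ = 0) →
      ∀ w ∈ K, ⟪toL2 u, w⟫_ℝ = 0 := by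
    intro u hu w hw
    have hle : K ≤ (ℝ ∙ toL2 u)ᗮ := by
      rw [hKdef]
      refine Submodule.topologicalClosure_minimal _ (Submodule.span_le.2 ?_) (Submodule.isClosed_orthogonal _)
      rintro v ⟨ψ, h1, h2, rfl⟩
      rw [SetLike.mem_coe, Submodule.mem_orthogonal_singleton_iff_inner_right, inner_toL2]
      exact hu ψ h1 h2
    exact (Submodule.mem_orthogonal_singleton_iff_inner_right).1 (hle hw)
  -- physical functions supported off the tube are orthogonal to every admissible `ψ`
  have hoff : ∀ (k : GaugeConfig 3 L SU2 → ℝ) (ψ : physSubmodule L),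
      (∀ U, η < wilsonAction su2Rep U → (ψ : GaugeConfig 3 L SU2 → ℝ) U = 0) →
      l2 (Tbᶜ.indicator k) ψ = 0 := by
    intro k ψ hψs
    rw [l2_indicator_left]
    have hz : Tbᶜ.indicator (ψ : GaugeConfig 3 L SU2 → ℝ) = fun _ => 0 := by
      funext U
      by_cases hU : U ∈ Tb
      · exact Set.indicator_of_notMem (fun h : U ∈ Tbᶜ => (Set.mem_compl_iff Tb U).1 h hU) _
      · rw [Set.indicator_of_mem ((Set.mem_compl_iff Tb U).2 hU)]
        exact hψs U ((hnotin U).1 hU)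
    rw [hz]
    simp [l2]
  -- the compression `Tc = P_K A|_K`
  set Tc : K →L[ℝ] K := K.orthogonalProjectionOnto.comp (A.comp K.subtypeL) with hTcdef
  have hTc_inner : ∀ u w : K, ⟪Tc u, w⟫_ℝ = ⟪A (u : Lp ℝ 2 (configMeasure SU2 L)), (w : Lp ℝ 2 (configMeasure SU2 L))⟫_ℝ := by
    intro u w
    show ⟪K.orthogonalProjectionOnto (A (K.subtypeL u)), w⟫_ℝ = _
    rw [Submodule.inner_orthogonalProjectionOnto_eq_of_mem_right, Submodule.subtypeL_apply]
  have hTc_sa : IsSelfAdjoint Tc := by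
    rw [ContinuousLinearMap.isSelfAdjoint_iff_isSymmetric]
    intro u w
    show ⟪Tc u, w⟫_ℝ = ⟪u, Tc w⟫_ℝ
    rw [hTc_inner, real_inner_comm (Tc w), hTc_inner, hAsym (u : Lp ℝ 2 (configMeasure SU2 L)) (w : Lp ℝ 2 (configMeasure SU2 L))]
    exact real_inner_comm _ _
  have hTc_c : IsCompactOperator Tc := (hAc.comp_clm K.subtypeL).clm_comp K.orthogonalProjectionOnto
  have hTc_pos : ∀ x : K, 0 ≤ ⟪x, Tc x⟫_ℝ := fun x => by
    rw [real_inner_comm, hTc_inner, real_inner_comm]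
    exact inner_apply_nonneg hA hβ.le (hKphys x.2)
  -- `K ≠ {0}`: the witness
  obtain ⟨ψ₀, hψ₀, -, hψ₀o, hψ₀s, hψ₀pos⟩ := exists_tube_witness (L := L) hη0 hΩ
  have hv₀K : toL2 (⟨ψ₀, hψ₀⟩ : physSubmodule L) ∈ K := hS₀K hψ₀o hψ₀s
  have hv₀ne : toL2 (⟨ψ₀, hψ₀⟩ : physSubmodule L) ≠ 0 := by
    intro h
    have h2 := norm_sq_toL2 (⟨ψ₀, hψ₀⟩ : physSubmodule L)
    rw [h, norm_zero] at h2
    simp only [ne_eq, OfNat.ofNat_ne_zero, not_false_eq_true, zero_pow] at h2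
    exact absurd h2.symm hψ₀pos.ne'
  haveI : Nontrivial K := ⟨⟨⟨_, hv₀K⟩, 0, fun h => hv₀ne (congrArg Subtype.val h)⟩⟩
  -- the top eigenvector of the compression
  obtain ⟨x, lam, hx1, hTx, hdom⟩ := exists_top_eigen_real Tc hTc_sa hTc_c hTc_pos
  -- every admissible `φ` has Rayleigh quotient `≤ lam`
  have hmax : ∀ φ : GaugeConfig 3 L SU2 → ℝ, (hφ : IsPhys φ) → l2 φ Ω = 0 →
      (∀ U, η < wilsonAction su2Rep U → φ U = 0) → qform su2Rep β φ φ ≤ lam * l2 φ φ := by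
    intro φ hφ hφo hφs
    have hyK : toL2 (⟨φ, hφ⟩ : physSubmodule L) ∈ K := hS₀K hφo hφs
    have h1 := hdom ⟨_, hyK⟩
    rw [real_inner_comm, hTc_inner] at h1
    have h2 : ⟪A (toL2 (⟨φ, hφ⟩ : physSubmodule L)), toL2 (⟨φ, hφ⟩ : physSubmodule L)⟫_ℝ = qform su2Rep β φ φ := by
      rw [real_inner_comm, inner_apply_toL2 hA]
    rw [Submodule.coe_norm, norm_sq_toL2] at h1
    simpa [h2] using h1
  by_cases hlam : lam ≤ 0
  · -- degenerate case: every admissible quotient vanishes; the witness is a maximiser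
    refine ⟨ψ₀, hψ₀, hψ₀o, hψ₀s, hψ₀pos, fun φ hφ hφo hφs => ?_⟩
    have h1 : qform su2Rep β φ φ ≤ 0 :=
      (hmax φ hφ hφo hφs).trans (mul_nonpos_of_nonpos_of_nonneg hlam (l2_self_nonneg φ))
    have h2 : 0 ≤ qform su2Rep β ψ₀ ψ₀ := qform_su2Rep_self_nonneg hβ.le hψ₀
    nlinarith [l2_self_nonneg φ, hψ₀pos]
  · -- `lam > 0`: the admissible representative of the eigenvector
    have hlam0 : 0 < lam := lt_of_not_ge hlam
    have hxphys : (x : Lp ℝ 2 (configMeasure SU2 L)) ∈ physL2 L := hKphys x.2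
    -- the physical representative `K_β x` of `A x`
    have hKx : IsPhys (transferApply β ((x : Lp ℝ 2 (configMeasure SU2 L)) : GaugeConfig 3 L SU2 → ℝ)) :=
      isPhys_transferApply_coe β hxphys
    obtain ⟨KxP, hKxP, hAx⟩ : ∃ KxP : physSubmodule L,
        (KxP : GaugeConfig 3 L SU2 → ℝ) = transferApply β ((x : Lp ℝ 2 (configMeasure SU2 L)) : GaugeConfig 3 L SU2 → ℝ) ∧
          toL2 KxP = A (x : Lp ℝ 2 (configMeasure SU2 L)) :=
      ⟨⟨_, hKx⟩, rfl, toL2_transferApply_coe hA hxphys⟩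
    -- the pieces `g = 1_T K_βx`, `gᶜ = 1_{Tᶜ} K_βx`, `v = 1_T Ω`, `vᶜ = 1_{Tᶜ} Ω`
    have hg : IsPhys (Tb.indicator (transferApply β ((x : Lp ℝ 2 (configMeasure SU2 L)) : GaugeConfig 3 L SU2 → ℝ))) :=
      isPhys_indicator_tube η hKx
    have hgc : IsPhys (Tbᶜ.indicator (transferApply β ((x : Lp ℝ 2 (configMeasure SU2 L)) : GaugeConfig 3 L SU2 → ℝ))) :=
      isPhys_indicator_tube_compl η hKx
    have hv : IsPhys (Tb.indicator Ω) := isPhys_indicator_tube η hΩ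
    have hvc : IsPhys (Tbᶜ.indicator Ω) := isPhys_indicator_tube_compl η hΩ
    obtain ⟨gP, hgP⟩ : ∃ gP : physSubmodule L,
        (gP : GaugeConfig 3 L SU2 → ℝ) = Tb.indicator (transferApply β ((x : Lp ℝ 2 (configMeasure SU2 L)) : GaugeConfig 3 L SU2 → ℝ)) :=
      ⟨⟨_, hg⟩, rfl⟩
    obtain ⟨gcP, hgcP⟩ : ∃ gcP : physSubmodule L,
        (gcP : GaugeConfig 3 L SU2 → ℝ) = Tbᶜ.indicator (transferApply β ((x : Lp ℝ 2 (configMeasure SU2 L)) : GaugeConfig 3 L SU2 → ℝ)) :=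
      ⟨⟨_, hgc⟩, rfl⟩
    obtain ⟨vP, hvP⟩ : ∃ vP : physSubmodule L, (vP : GaugeConfig 3 L SU2 → ℝ) = Tb.indicator Ω := ⟨⟨_, hv⟩, rfl⟩
    obtain ⟨vcP, hvcP⟩ : ∃ vcP : physSubmodule L, (vcP : GaugeConfig 3 L SU2 → ℝ) = Tbᶜ.indicator Ω := ⟨⟨_, hvc⟩, rfl⟩
    obtain ⟨ΩP, hΩP⟩ : ∃ ΩP : physSubmodule L, (ΩP : GaugeConfig 3 L SU2 → ℝ) = Ω := ⟨⟨_, hΩ⟩, rfl⟩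
    -- the re-orthogonalisation coefficient and `ĝ = g − c v`
    obtain ⟨m, hm⟩ : ∃ m : ℝ, m = l2 (Tb.indicator Ω) (Tb.indicator Ω) := ⟨_, rfl⟩
    obtain ⟨c, hc⟩ : ∃ c : ℝ,
        c = l2 (Tb.indicator (transferApply β ((x : Lp ℝ 2 (configMeasure SU2 L)) : GaugeConfig 3 L SU2 → ℝ))) Ω / m := ⟨_, rfl⟩
    obtain ⟨ĝP, hĝP⟩ : ∃ ĝP : physSubmodule L, ĝP = gP + (-c) • vP := ⟨_, rfl⟩
    have hĝ_coe : (ĝP : GaugeConfig 3 L SU2 → ℝ) =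
        Tb.indicator (transferApply β ((x : Lp ℝ 2 (configMeasure SU2 L)) : GaugeConfig 3 L SU2 → ℝ)) + (-c) • Tb.indicator Ω := by
      rw [hĝP, Submodule.coe_add, Submodule.coe_smul, hgP, hvP]
    -- (i) `ĝ ⊥ Ω`
    have hĝ_orth : l2 (ĝP : GaugeConfig 3 L SU2 → ℝ) Ω = 0 := by
      rw [hĝ_coe, l2_add_left hg (hv.smul (-c)) hΩ, l2_smul_left, l2_indicator_left Tb Ω Ω, ← hm]
      by_cases hm0 : m = 0
      · -- then `1_T Ω = 0` in `L²` and `⟨1_T K_βx, Ω⟩ = ⟨1_T K_βx, 1_T Ω⟩ = 0` by Cauchy–Schwarz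
        have h1 : l2 (Tb.indicator (transferApply β ((x : Lp ℝ 2 (configMeasure SU2 L)) : GaugeConfig 3 L SU2 → ℝ))) Ω = 0 := by
          rw [l2_indicator_left]
          have hcs := sq_l2_le hg hv
          rw [← hm, hm0, mul_zero] at hcs
          exact pow_eq_zero_iff (n := 2) (by norm_num) |>.1 (le_antisymm hcs (sq_nonneg _))
        rw [h1, hm0]; ring
      · rw [hc]; field_simp; ring
    -- (ii) `ĝ` vanishes off the tube
    have hĝ_supp : ∀ U, η < wilsonAction su2Rep U → (ĝP : GaugeConfig 3 L SU2 → ℝ) U = 0 := by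
      intro U hU
      have hUT : U ∉ Tb := (hnotin U).2 hU
      rw [hĝ_coe]
      simp only [Pi.add_apply, Pi.smul_apply, smul_eq_mul, Set.indicator_of_notMem hUT, mul_zero, add_zero]
    -- (iii) its class lies in `K`
    have hĝK : toL2 ĝP ∈ K := hS₀K hĝ_orth hĝ_supp
    -- (iv) `A x − [ĝ]` is orthogonal to `K`: it is the class of `1_{Tᶜ}K_βx + c·1_TΩ`
    have hdiff : A (x : Lp ℝ 2 (configMeasure SU2 L)) - toL2 ĝP = toL2 gcP + c • toL2 vP := by
      rw [← hAx, ← map_smul, ← map_add, ← sub_eq_zero, ← map_sub, ← map_sub]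
      have : KxP - ĝP - (gcP + c • vP) = 0 := by
        apply Subtype.ext
        rw [Submodule.coe_sub, Submodule.coe_sub, Submodule.coe_add, Submodule.coe_smul, hKxP, hĝ_coe, hgcP, hvP,
          Submodule.coe_zero]
        funext U
        have h := congrFun (Set.indicator_self_add_compl Tb
          (transferApply β ((x : Lp ℝ 2 (configMeasure SU2 L)) : GaugeConfig 3 L SU2 → ℝ))) U
        simp only [Pi.add_apply] at h
        simp only [Pi.sub_apply, Pi.add_apply, Pi.smul_apply, smul_eq_mul, Pi.zero_apply]
        linarith
      rw [this, map_zero]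
    have hvP_eq : toL2 vP = toL2 ΩP - toL2 vcP := by
      rw [← map_sub]
      congr 1
      apply Subtype.ext
      rw [Submodule.coe_sub, hvP, hΩP, hvcP]
      funext U
      have h := congrFun (Set.indicator_self_add_compl Tb Ω) U
      simp only [Pi.add_apply] at h
      simp only [Pi.sub_apply]
      linarith
    have horthK : A (x : Lp ℝ 2 (configMeasure SU2 L)) - toL2 ĝP ∈ Kᗮ := by
      rw [Submodule.mem_orthogonal]
      intro w hw
      rw [real_inner_comm, hdiff, hvP_eq, inner_add_left, inner_smul_left, inner_sub_left]
      have h1 : ⟪toL2 gcP, w⟫_ℝ = 0 :=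
        hKorth gcP (fun ψ _ hψs => by rw [hgcP]; exact hoff _ ψ hψs) w hw
      have h2 : ⟪toL2 vcP, w⟫_ℝ = 0 :=
        hKorth vcP (fun ψ _ hψs => by rw [hvcP]; exact hoff _ ψ hψs) w hw
      have h3 : ⟪toL2 ΩP, w⟫_ℝ = 0 :=
        hKorth ΩP (fun ψ hψo _ => by rw [hΩP, l2_comm]; exact hψo) w hw
      simp [h1, h2, h3]
    -- (v) hence `P_K (A x) = [ĝ]`, i.e. `lam • x = [ĝ]`
    have hproj : K.starProjection (A (x : Lp ℝ 2 (configMeasure SU2 L))) = toL2 ĝP :=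
      Submodule.eq_starProjection_of_mem_orthogonal hĝK horthK
    have hTx' : K.orthogonalProjectionOnto (A (x : Lp ℝ 2 (configMeasure SU2 L))) = lam • x := by
      have h := hTx
      rw [hTcdef] at h
      simpa only [ContinuousLinearMap.coe_comp, Function.comp_apply, Submodule.subtypeL_apply] using h
    have hx_eq : lam • (x : Lp ℝ 2 (configMeasure SU2 L)) = toL2 ĝP := by
      have h := congrArg Subtype.val hTx'
      rw [← Submodule.starProjection_apply, hproj, Submodule.coe_smul] at h
      exact h.symm
    -- the witness `ψ = lam⁻¹ • ĝ`
    obtain ⟨μ, hμ⟩ : ∃ μ : ℝ, μ = lam⁻¹ := ⟨_, rfl⟩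
    obtain ⟨ψP, hψP⟩ : ∃ ψP : physSubmodule L, ψP = μ • ĝP := ⟨_, rfl⟩
    have hψ_coe : (ψP : GaugeConfig 3 L SU2 → ℝ) = μ • (ĝP : GaugeConfig 3 L SU2 → ℝ) := by
      rw [hψP, Submodule.coe_smul]
    have hxψ : toL2 ψP = (x : Lp ℝ 2 (configMeasure SU2 L)) := by
      rw [hψP, map_smul, ← hx_eq, smul_smul, hμ, inv_mul_cancel₀ hlam0.ne', one_smul]
    have hnormψ : l2 (ψP : GaugeConfig 3 L SU2 → ℝ) ψP = 1 := by
      rw [← norm_sq_toL2, hxψ, ← Submodule.coe_norm, hx1, one_pow]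
    have hqψ : qform su2Rep β (ψP : GaugeConfig 3 L SU2 → ℝ) ψP = lam := by
      rw [← inner_apply_toL2 hA, hxψ]
      have h1 := hTc_inner x x
      rw [hTx, real_inner_smul_left, real_inner_self_eq_norm_sq, hx1, one_pow, mul_one] at h1
      rw [real_inner_comm, ← h1]
    refine ⟨(ψP : GaugeConfig 3 L SU2 → ℝ), isPhys_coe ψP, ?_, fun U hU => ?_, by rw [hnormψ]; exact one_pos,
      fun φ hφ hφo hφs => ?_⟩
    · rw [hψ_coe, l2_smul_left, hĝ_orth, mul_zero]
    · rw [hψ_coe, Pi.smul_apply, smul_eq_mul, hĝ_supp U hU, mul_zero]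
    · rw [hnormψ, hqψ, mul_one]
      exact hmax φ hφ hφo hφs

/-! ## §3 The item by name -/

/-- ★★★ **Support item `TubeMaximiser` of route FlatTubeReduction (stmt-QuantumFields-24923), PROVED**: the route decl by name.
R2b1 is a RECORD rung; the Born–Oppenheimer cruxes K1a `PinnedTubeRatioLaw`, K1b `ValleyRelocalisation` and the two ladder legs stay open; no
summit (in particular not the Yang–Mills mass gap) is proved by this. [cite: ReedSimonIV1978, Thm. XIII.1] -/
theorem _root_.Summit.QuantumFields.YangMills.Theorems.FlatTubeReduction.tubeMaximiser_proof :
    Summit.QuantumFields.YangMills.Theses.FlatTubeReduction.TubeMaximiser :=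
  fun L _ θ β hθ hβ Ω hΩ => tubeMaximiser_core L θ β hθ hβ Ω hΩ

end TubeMax

end Summit.QuantumFields.YangMills.Theorems.FemtoTransferGap

end
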